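import Summits.QuantumFields.YangMills.Theorems.BalabanUVNodesN22KernelFadingOfStepRate
import Summits.QuantumFields.YangMills.Theorems.BalabanUVNodesN18RunningBetaLettersModel

/-!
# BalabanUVNodes ∕ node N22 = NE9 — THE F-E SHADOW ON NODE N22's FADING LETTER: what «first-entry-only kernels» do to K3⁸'s N22 conjunct
# `h9 : NE9 ((objectsOfRecord₁₃ F 2 θ ℓ).EA 0) (Window θ.γ) ℓ.κ ℓ.moduli` with the record's GEOMETRIC moduli `ℓ.moduli n i = ℓ.C₉·ℓ.ω^{n−i}` —
# RIGIDITY from the letter, the exact CONTRAPOSITIVES (generic, at the record, at the pinned bundle), and FAILURE of the letter at CRIT-2's marginal-transport toy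
# in def-B currency (LOCATED statements in hypothesis form + a model; nothing asserted of Bałaban's record)

Cell `pub-ymgap`, HUMAN RULING D-0062 (Track A), WIDTH SEAT `pub-ymgap-dag-n22-w2` (g5; A6-residue FLAG №3 lane of node N22).  THEOREMS ONLY (no `def`, no `sorry`,
standard axioms); `--kind proof --supports stmt-QuantumFields-27366 --as helper` (K3⁸ `SpineGivenEndpointR13SepCoPHV`, dag-lead KEY MAP v2), COUNT-NEUTRAL.  Imports
dag-n22-c's module J38 `…Theorems.BalabanUVNodesN22KernelFadingOfStepRate` (for `ne9_mono`, `update_mem_window`, and through it dag-n22-w3's `…N22AtU3OfKernels`, W1-19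
`Node00.U3OfKernels`, W1-21, `T4OutputRate`) and dag-n18-w2's `…Theorems.BalabanUVNodesN18RunningBetaLettersModel` (the mixed two-bond family `crossTermFamily F a e` with
W1-19's `kernelA` in CLOSED FORM, `crossKernel_zero_one`, `objects`), BY NAME.  Nothing re-declared.  The N22 counterpart of width seat dag-n18-w1 g6's N18-side files
(`…N18KernelLettersFirstEntryOnly` ∕ `…Model`): the FE binder below is BYTE-IDENTICAL to theirs, so the two compose; their N22 remark (the SURVIVOR `ne9_EA_marginalTransport`:
NE9 with a BOUNDED first-entry modulus) is theirs and is not re-typed here.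

THE FINDING (ym-nodeO lineage, DISPLAYED here, never asserted).  IDEA-1 g12 located that the record's effective action reads the coupling history through its FIRST entry
only (`Node00/BackgroundActionT`: `effActionHT = printedSeq … (wilsonTerm (g 0))`, the free entries `j ≥ 1` entering as gauge-fixing prefactors); CRIT-1 g5∕g6 confirmed;
CRIT-2 g3 (E-CRIT2-2): «geometric letters `ScaleShiftRate` ∕ `FadingMemory` presumptively FALSE at the current record mod H_FE′».  In W1-19's kernel currency the shadow is
the hypothesis **FE**: `∀ g g′ ∈ ]0,γ]^ℕ, g 0 = g′ 0 → Π_{k+1}(g; ·) = Π_{k+1}(g′; ·)` — the limiting kernels read the BARE coupling only.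

WHAT THIS FILE PROVES (all `theorem`).
* §1 ANY functional `E` on ANY carriers (then W1-19's `EA F ℰ ρ bV`): ★ `abs_sub_le_of_ne9_fading_firstEntryOnly` — RIGIDITY FROM N22's LETTER: `NE9 E (Window γ) κ Λ` ∧
  `FadingMemory C₉ ω Λ` ∧ FE ⟹ `|E(g)(X) − E(g′)(X)| ≤ C₉·ω^{scale X}·|g 0 − g′ 0|·e^{−κ d(X)}` for ALL window histories (FE moves `g` to `g′|g′_0 := g_0`; NE9 between two
  histories differing at the bare entry only; `Finset.sum_eq_single 0`) — the functional is COUPLING-BLIND TO GEOMETRIC ORDER; `abs_kernelA_sub_le_of_ne9_fading_firstEntryOnly`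
  (kernel words: `≤ C₉ω^{k+1}|g 0 − g′ 0|e^{−κ|z|₁}`); ★ `not_ne9_fading_of_firstEntryOnly_of_gap` (FE ∧ ONE bare-coupling gap beating `C₉ω^{scale X}|g 0 − g′ 0|e^{−κ d(X)}` ⟹
  ¬(NE9 … Λ ∧ FadingMemory C₉ ω Λ)) · ★ `not_ne9_geometric_of_firstEntryOnly_of_gap` (the record's moduli SHAPE `C₉ω^{n−i}`: FE ∧ gap ⟹ ¬ NE9 … (C₉ω^{n−i}), `0 ≤ C₉`, `0 ≤ ω`).
* §2 AT THE RECORD (`objectsOfRecord₁₃ F N θ ℓ` — W1-19's objects at the SAME merged term family `mergedTermFamilyMatT … (TβOfRecord₁₃) (chiβOfRecord₁₃ θ) θ.εbg` that IDEA-1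
  located; FE-of-record DISPLAYED in the functional currency of `h9`): ★ `abs_EA_objectsOfRecord₁₃_sub_le_of_h9_firstEntryOnly` (`h9` ∧ `ℓ.Signs` ∧ FE ⟹
  `|ΔΠ| ≤ ℓ.C₉·ℓ.ω^{scale X}·|g 0 − g′ 0|·e^{−ℓ.κ d(X)}`) · ★★ `not_h9_of_firstEntryOnly_of_gap` (FE-of-record ∧ ONE bare-coupling gap beating `ℓ.C₉ℓ.ω^{scale}…` ⟹ ¬ `h9` for
  THAT block) · ★★ `not_h9_of_firstEntryOnly_of_notRigid` (FE-of-record ∧ «no geometric rigidity at ANY `(C, ω < 1, κ ≥ 0)`» ⟹ ¬ `h9` for EVERY block with `ℓ.Signs`) ·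
  ★ `not_n22At_rateCarriers_pin_of_firstEntryOnly_of_notRigid` (the K3 pin face: under `hpin`, ¬ `N22At (rateCarriersOfRecord₁₃CoPH 𝔯 F θ hP g₀ os k).u3`, dag-n22-w3's
  `n22At_u3OfRecord₁₃_objectsOfRecord₁₃_iff` `.1`).
* §3 AT CRIT-2's MARGINAL-TRANSPORT TOY in def-B currency (dag-n18-w2's `crossTermFamily F a e` with the amplitude law DISPLAYED as dag-n18-w1 g6 displays it,
  `ha : ∀ k v, a k v = β₀ + α·(v 0)²∕(1 + c·k·(v 0)²)` — first-entry-only, memory of the bare coupling fading POLYNOMIALLY, like asymptotic freedom's `g_k² ≈ g_0²∕(1 + ckg_0²)`):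
  `kernelA_zero_one_const_marginalTransport` (the mixed entry at a CONSTANT history) · `abs_kernelGap_const_marginalTransport_ge` (two constant histories `γ`, `γ∕2`: the gap at
  `z = e` is `≥ |α|·(3γ²∕4)∕(1 + c·k·γ²)²` — POLYNOMIAL in `k`) · `false_of_inv_sq_le_geometric` (`A∕(1 + bk)² ≤ B·ω^{k+1} ∀ k`, `A > 0`, `0 ≤ ω < 1` ⟹ `False`;
  `tendsto_pow_const_mul_const_pow_of_abs_lt_one`) · ★★ `not_ne9_geometric_marginalTransport` (`α ≠ 0`, `0 ≤ c`, `0 < γ`: for EVERY `C₉`, EVERY `ω ∈ [0,1[`, EVERY `κ`,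
  ¬ `NE9 (EA F (crossTermFamily F a e) id bV) (Window γ) κ (fun n i ↦ C₉·ω^{n−i})` — N22's letter WITH THE RECORD's MODULI SHAPE FAILS at the toy) ·
  ★ `not_n22At_objects_marginalTransport` (¬ `N22At (u3OfRecord₁₃ θ (objects F (crossTermFamily F a e) id bV ℓ) k)` for EVERY block `ℓ` with `ℓ.Signs`, every Stage-13 `θ` with
  `0 < θ.γ`, every `k`).  CONTRAST (by name): at this seat's QUADRATIC FADING model (`…N22KernelFadingOfStepRateModel` ∕ `…NonDegenerate`, p626291 ∕ p627338) the same letter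
  HOLDS non-degenerately (`ne9_and_fadingMemory_quadCross`, `n22At_quadCross`) — the letter is consistent; what kills it is first-entry-only dependence whose bare-coupling
  memory is not geometrically small, exactly the marginal-transport shape.

HONEST FRAMING (binding).  LOCATED statements in HYPOTHESIS form and a MODEL.  FE-of-record is a DISPLAYED hypothesis, never asserted (its status is the ym-nodeO lineage's:
«presumptively, mod H_FE′»); NO theorem here refutes K3⁸'s `stub_rates13HV` ∕ `stub_expansion13HV`, the N22 conjunct `h9`, or any ledger item — §2 says exactly «FE-of-record ∧
a bare-coupling kernel gap ⟹ ¬ h9», with BOTH antecedents displayed; §3's object is a scalar two-bond test functional, NOT Bałaban's merged term (1.6) ∕ (2.13).  Nothing of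
Bałaban's is proved or asserted; NE5 ∕ NE9 are NOT PRINTED for d = 4; N22 ∕ N18 ∕ (D4) NOT discharged (typed 28∕28 · discharged 5∕27 UNMOVED — the chair's single count line is
the only count); K3⁸ OPEN, NOT claimed, no stub proved or refuted; one finite 𝕋⁴ programme at fixed ε — R4 closes the CONDITIONAL rung `BalabanLadder.UV` only; NOTHING about the
continuum limit, ℝ⁴, infinite volume, OS axioms, a mass gap or the Clay problem is proved or claimed.  References (TYPES only): [I] = Bałaban, CMP 109 (1987) Thm 1 p. 259,
(1.18) p. 263, (1.20)–(1.22) p. 264, §5 p. 298 («β_j depends also on all preceding coupling constants»); [II] = CMP 116 (1988) (2.13)–(2.14) pp. 14–15.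
-/

noncomputable section

open Filter Topology Set
open scoped BigOperators

namespace YMDAG.N22.FadingLetterFirstEntryOnly

open Literature.MathematicalPhysics.QuantumFieldTheory.Balaban1983to89
open Literature.MathematicalPhysics.QuantumFieldTheory.Balaban1983to89.T4Continuum (T4Family ULoop)
open Literature.MathematicalPhysics.QuantumFieldTheory.Balaban1983to89.T4OutputRate (Carriers Functional Window NE9 FadingMemory)
open Literature.MathematicalPhysics.QuantumFieldTheory.Balaban1983to89.FlowStep (HBeta)
open Literature.MathematicalPhysics.QuantumFieldTheory.Balaban1983to89.Node00 (TermFamily1 Stage13Params Stage13HParams U3Letters₁₁)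
open Literature.MathematicalPhysics.QuantumFieldTheory.Balaban1983to89.Node00.U3OfKernels (carriers histPrefix histPrefix_apply kernelA EA EA_apply objects objectsOfRecord₁₃)
open Literature.MathematicalPhysics.QuantumFieldTheory.Balaban1983to89.B12Sec2to5 (l1)
open YMDAG.UVSplit (N22At u3OfRecord₁₃ RateReading₁₃CoPH rateCarriersOfRecord₁₃CoPH)
open YMDAG.N22.AtKernels (n22At_u3OfRecord₁₃_objects_iff n22At_u3OfRecord₁₃_objectsOfRecord₁₃_iff)
open YMDAG.N22.KernelFading (ne9_mono update_mem_window)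
open YMDAG.N18.RunningBetaLettersModel (crossKernel crossKernel_zero_one crossTermFamily kernelA_crossTermFamily)

/-! ## §1 Rigidity from N22's letter under first-entry-only dependence, and the contrapositives (any functional, any carriers) -/

section Generic

variable {C : Carriers} {Bg : Type} {E : Functional C Bg}

/-- ★ **RIGIDITY FROM N22's LETTER UNDER FIRST-ENTRY-ONLY DEPENDENCE.**  If a level functional `E` on the window `]0, γ]^ℕ` satisfies N22's letter `NE9 E (Window γ) κ Λ` with
FADING moduli `FadingMemory C₉ ω Λ` and reads the history through its BARE coupling only (FE, DISPLAYED), then for ALL window histories `g, g′` and every domain `X`,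
`|E(g)(X) − E(g′)(X)| ≤ C₉·ω^{scale X}·|g 0 − g′ 0|·e^{−κ d(X)}`: FE replaces `g` by `g′` updated at the bare entry to `g 0`; the two then differ at entry `0` only, where the modulus is
`Λ (scale X) 0 ≤ C₉ ω^{scale X}` — the functional is COUPLING-BLIND TO GEOMETRIC ORDER in the scale. [folklore] -/
theorem abs_sub_le_of_ne9_fading_firstEntryOnly {γ κ C₉ ω : ℝ} {Λ : ℕ → ℕ → ℝ} (h9 : NE9 E (Window γ) κ Λ) (hfm : FadingMemory C₉ ω Λ)
    (hFE : ∀ g ∈ Window γ, ∀ g' ∈ Window γ, g 0 = g' 0 → ∀ (U : Bg) (X : C.Dom), E g U X = E g' U X) :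
    ∀ g ∈ Window γ, ∀ g' ∈ Window γ, ∀ (U : Bg) (X : C.Dom),
      |E g U X - E g' U X| ≤ C₉ * ω ^ C.scale X * |g 0 - g' 0| * Real.exp (-(κ * C.d X)) := by
  intro g hg g' hg' U X
  -- move `g` to `g'` updated at the bare entry
  have hh : Function.update g' 0 (g 0) ∈ Window γ := update_mem_window hg' 0 ⟨(hg 0).1, (hg 0).2⟩
  have hEq : E g U X = E (Function.update g' 0 (g 0)) U X := hFE g hg _ hh (by rw [Function.update_self]) U X
  rw [hEq]
  have hC₉ : 0 ≤ C₉ := by have h := hfm 0 0 le_rfl; rw [Nat.sub_zero, pow_zero, mul_one] at h; exact h.1.trans h.2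
  have hne := h9 _ hh g' hg' U X
  rcases Nat.eq_zero_or_pos (C.scale X) with h0 | hpos
  · -- scale `0`: the NE9 sum is empty
    rw [h0, Finset.range_zero, Finset.sum_empty, mul_zero] at hne
    have hz : |E (Function.update g' 0 (g 0)) U X - E g' U X| = 0 := le_antisymm hne (abs_nonneg _)
    rw [hz, h0, pow_zero, mul_one]
    positivity
  · -- scale `≥ 1`: only the bare entry contributes
    have hsum : ∑ i ∈ Finset.range (C.scale X), Λ (C.scale X) i * |Function.update g' 0 (g 0) i - g' i| = Λ (C.scale X) 0 * |g 0 - g' 0| := by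
      rw [Finset.sum_eq_single 0]
      · rw [Function.update_self]
      · intro i _ hi
        rw [Function.update_of_ne hi, sub_self, abs_zero, mul_zero]
      · intro h
        exact absurd (Finset.mem_range.2 hpos) h
    rw [hsum] at hne
    have hΛ := (hfm (C.scale X) 0 (Nat.zero_le _)).2
    rw [Nat.sub_zero] at hΛ
    calc |E (Function.update g' 0 (g 0)) U X - E g' U X| ≤ Real.exp (-(κ * C.d X)) * (Λ (C.scale X) 0 * |g 0 - g' 0|) := hne
      _ ≤ Real.exp (-(κ * C.d X)) * (C₉ * ω ^ C.scale X * |g 0 - g' 0|) :=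
          mul_le_mul_of_nonneg_left (mul_le_mul_of_nonneg_right hΛ (abs_nonneg _)) (Real.exp_nonneg _)
      _ = C₉ * ω ^ C.scale X * |g 0 - g' 0| * Real.exp (-(κ * C.d X)) := by ring

/-- ★ **THE CONTRAPOSITIVE**: under FE, ONE bare-coupling gap beating the geometric bound — `C₉·ω^{scale X}·|g 0 − g′ 0|·e^{−κ d(X)} < |E(g)(X) − E(g′)(X)|` for some window
histories `g, g′` and domain `X` — EXCLUDES N22's letter with fading moduli `(Λ, C₉, ω)`, whatever `Λ`. [folklore] -/
theorem not_ne9_fading_of_firstEntryOnly_of_gap {γ κ C₉ ω : ℝ} {Λ : ℕ → ℕ → ℝ}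
    (hFE : ∀ g ∈ Window γ, ∀ g' ∈ Window γ, g 0 = g' 0 → ∀ (U : Bg) (X : C.Dom), E g U X = E g' U X)
    {g g' : ℕ → ℝ} (hg : g ∈ Window γ) (hg' : g' ∈ Window γ) {U : Bg} {X : C.Dom}
    (hgap : C₉ * ω ^ C.scale X * |g 0 - g' 0| * Real.exp (-(κ * C.d X)) < |E g U X - E g' U X|) :
    ¬ (NE9 E (Window γ) κ Λ ∧ FadingMemory C₉ ω Λ) :=
  fun h => (not_lt.2 (abs_sub_le_of_ne9_fading_firstEntryOnly h.1 h.2 hFE g hg g' hg' U X)) hgap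

/-- ★ **THE RECORD's MODULI SHAPE EXCLUDED**: the geometric table `Λ n i = C₉·ω^{n−i}` (W1-21's `U3Letters₁₁.moduli`) IS fading-memory with its own constants when `0 ≤ C₉`, `0 ≤ ω`; so
under FE one bare-coupling gap beating `C₉·ω^{scale X}·|g 0 − g′ 0|·e^{−κ d(X)}` excludes `NE9 E (Window γ) κ (fun n i ↦ C₉·ω^{n−i})`. [folklore] -/
theorem not_ne9_geometric_of_firstEntryOnly_of_gap {γ κ C₉ ω : ℝ} (hC₉ : 0 ≤ C₉) (hω : 0 ≤ ω)
    (hFE : ∀ g ∈ Window γ, ∀ g' ∈ Window γ, g 0 = g' 0 → ∀ (U : Bg) (X : C.Dom), E g U X = E g' U X)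
    {g g' : ℕ → ℝ} (hg : g ∈ Window γ) (hg' : g' ∈ Window γ) {U : Bg} {X : C.Dom}
    (hgap : C₉ * ω ^ C.scale X * |g 0 - g' 0| * Real.exp (-(κ * C.d X)) < |E g U X - E g' U X|) :
    ¬ NE9 E (Window γ) κ (fun n i => C₉ * ω ^ (n - i)) :=
  fun h => not_ne9_fading_of_firstEntryOnly_of_gap hFE hg hg' hgap ⟨h, fun _ _ _ => ⟨mul_nonneg hC₉ (pow_nonneg hω _), le_rfl⟩⟩

end Generic

section Kernels

variable {𝔄 : Type*} [NormedRing 𝔄] [NormedAlgebra ℝ 𝔄]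
variable {V : Type*} [NormedAddCommGroup V] [NormedSpace ℝ V] {ι : Type*} [Fintype ι]
variable (F : T4Family) (ℰ : TermFamily1 F 𝔄) (ρ : V →L[ℝ] 𝔄) (bV : Module.Basis ι ℝ V)

/-- **RIGIDITY IN KERNEL WORDS** (W1-19's `kernelA` of ANY term family, FE displayed exactly as in width seat dag-n18-w1's N18-side file): N22's letter with fading moduli ∧ FE ⟹
`|Π_{k+1}(g; z) − Π_{k+1}(g′; z)| ≤ C₉·ω^{k+1}·|g 0 − g′ 0|·e^{−κ|z|₁}` for ALL window histories and every `(k, μ, ν, z)`. [folklore] -/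
theorem abs_kernelA_sub_le_of_ne9_fading_firstEntryOnly {γ κ C₉ ω : ℝ} {Λ : ℕ → ℕ → ℝ} (h9 : NE9 (EA F ℰ ρ bV) (Window γ) κ Λ) (hfm : FadingMemory C₉ ω Λ)
    (hFE : ∀ g ∈ Window γ, ∀ g' ∈ Window γ, g 0 = g' 0 → ∀ (k : ℕ) (μ ν : Fin 4) (z : Fin 4 → ℤ), kernelA F ℰ ρ bV g k μ ν z = kernelA F ℰ ρ bV g' k μ ν z) :
    ∀ g ∈ Window γ, ∀ g' ∈ Window γ, ∀ (k : ℕ) (μ ν : Fin 4) (z : Fin 4 → ℤ),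
      |kernelA F ℰ ρ bV g k μ ν z - kernelA F ℰ ρ bV g' k μ ν z| ≤ C₉ * ω ^ (k + 1) * |g 0 - g' 0| * Real.exp (-(κ * l1 z)) := by
  intro g hg g' hg' k μ ν z
  have hFE' : ∀ g ∈ Window γ, ∀ g' ∈ Window γ, g 0 = g' 0 → ∀ (U : PUnit) (X : carriers.Dom), EA F ℰ ρ bV g U X = EA F ℰ ρ bV g' U X := by
    rintro g hg g' hg' h0 U ⟨k, μ, ν, z⟩
    rw [EA_apply, EA_apply]
    exact hFE g hg g' hg' h0 k μ ν z
  have h := abs_sub_le_of_ne9_fading_firstEntryOnly h9 hfm hFE' g hg g' hg' PUnit.unit (k, μ, ν, z)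
  rw [EA_apply, EA_apply] at h
  exact h

/-- **THE KERNEL-WORDS CONTRAPOSITIVE FOR THE RECORD's MODULI SHAPE**: FE ∧ ONE bare-coupling kernel gap `C₉·ω^{k+1}·|g 0 − g′ 0|·e^{−κ|z|₁} < |ΔΠ_{k+1}(z)|` ⟹
¬ `NE9 (EA F ℰ ρ bV) (Window γ) κ (fun n i ↦ C₉·ω^{n−i})` (`0 ≤ C₉`, `0 ≤ ω`). [folklore] -/
theorem not_ne9_geometric_EA_of_firstEntryOnly_of_kernelGap {γ κ C₉ ω : ℝ} (hC₉ : 0 ≤ C₉) (hω : 0 ≤ ω)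
    (hFE : ∀ g ∈ Window γ, ∀ g' ∈ Window γ, g 0 = g' 0 → ∀ (k : ℕ) (μ ν : Fin 4) (z : Fin 4 → ℤ), kernelA F ℰ ρ bV g k μ ν z = kernelA F ℰ ρ bV g' k μ ν z)
    {g g' : ℕ → ℝ} (hg : g ∈ Window γ) (hg' : g' ∈ Window γ) {k : ℕ} {μ ν : Fin 4} {z : Fin 4 → ℤ}
    (hgap : C₉ * ω ^ (k + 1) * |g 0 - g' 0| * Real.exp (-(κ * l1 z)) < |kernelA F ℰ ρ bV g k μ ν z - kernelA F ℰ ρ bV g' k μ ν z|) :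
    ¬ NE9 (EA F ℰ ρ bV) (Window γ) κ (fun n i => C₉ * ω ^ (n - i)) := by
  intro h
  have hfm : FadingMemory C₉ ω (fun n i => C₉ * ω ^ (n - i)) := fun _ _ _ => ⟨mul_nonneg hC₉ (pow_nonneg hω _), le_rfl⟩
  exact (not_lt.2 (abs_kernelA_sub_le_of_ne9_fading_firstEntryOnly F ℰ ρ bV h hfm hFE g hg g' hg' k μ ν z)) hgap

end Kernels

/-! ## §2 AT THE RECORD: K3⁸'s N22 conjunct `h9` under first-entry-only kernels of record (FE-of-record DISPLAYED, never asserted) -/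

section Record

variable (F : T4Family) (N : ℕ) [NeZero N]

/-- ★ **RIGIDITY OF THE RECORD's KERNEL FUNCTIONAL FROM `h9`.**  At a Stage-13 tuple `θ` and a letter block `ℓ` with its signs: K3's N22 conjunct
`h9 : NE9 ((objectsOfRecord₁₃ F N θ ℓ).EA 0) (Window θ.γ) ℓ.κ ℓ.moduli` together with FE-of-record (the level functional of W1-19's objects of record — the limiting kernels of the
merged term family of record — reads the bare coupling only; DISPLAYED) gives `|ΔΠ(X)| ≤ ℓ.C₉·ℓ.ω^{scale X}·|g 0 − g′ 0|·e^{−ℓ.κ d(X)}` across ALL window histories: the record's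
kernels would be coupling-blind to geometric order.  LOCATED (hypothesis form); N22 NOT discharged. [folklore] -/
theorem abs_EA_objectsOfRecord₁₃_sub_le_of_h9_firstEntryOnly (θ : Stage13Params F N) (ℓ : U3Letters₁₁) (hs : ℓ.Signs)
    (h9 : NE9 ((objectsOfRecord₁₃ F N θ ℓ).EA 0) (Window θ.γ) ℓ.κ ℓ.moduli)
    (hFE : ∀ g ∈ Window θ.γ, ∀ g' ∈ Window θ.γ, g 0 = g' 0 → ∀ (U : PUnit) (X : ((objectsOfRecord₁₃ F N θ ℓ).levelCarriers 0).Dom),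
      (objectsOfRecord₁₃ F N θ ℓ).EA 0 g U X = (objectsOfRecord₁₃ F N θ ℓ).EA 0 g' U X) :
    ∀ g ∈ Window θ.γ, ∀ g' ∈ Window θ.γ, ∀ (U : PUnit) (X : ((objectsOfRecord₁₃ F N θ ℓ).levelCarriers 0).Dom),
      |(objectsOfRecord₁₃ F N θ ℓ).EA 0 g U X - (objectsOfRecord₁₃ F N θ ℓ).EA 0 g' U X| ≤
        ℓ.C₉ * ℓ.ω ^ ((objectsOfRecord₁₃ F N θ ℓ).levelCarriers 0).scale X * |g 0 - g' 0| *
          Real.exp (-(ℓ.κ * ((objectsOfRecord₁₃ F N θ ℓ).levelCarriers 0).d X)) :=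
  abs_sub_le_of_ne9_fading_firstEntryOnly h9 (fun n i _ => ⟨hs.moduli_nonneg n i, le_of_eq (ℓ.moduli_apply n i)⟩) hFE

/-- ★★ **THE CONTRAPOSITIVE AT THE RECORD, ONE BLOCK**: FE-of-record ∧ ONE bare-coupling gap in the record's kernel functional beating `ℓ.C₉·ℓ.ω^{scale X}·|g 0 − g′ 0|·e^{−ℓ.κ d(X)}`
⟹ ¬ K3's `h9` for THAT letter block.  BOTH antecedents DISPLAYED; nothing refuted. [folklore] -/
theorem not_h9_of_firstEntryOnly_of_gap (θ : Stage13Params F N) (ℓ : U3Letters₁₁) (hs : ℓ.Signs)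
    (hFE : ∀ g ∈ Window θ.γ, ∀ g' ∈ Window θ.γ, g 0 = g' 0 → ∀ (U : PUnit) (X : ((objectsOfRecord₁₃ F N θ ℓ).levelCarriers 0).Dom),
      (objectsOfRecord₁₃ F N θ ℓ).EA 0 g U X = (objectsOfRecord₁₃ F N θ ℓ).EA 0 g' U X)
    {g g' : ℕ → ℝ} (hg : g ∈ Window θ.γ) (hg' : g' ∈ Window θ.γ) {U : PUnit} {X : ((objectsOfRecord₁₃ F N θ ℓ).levelCarriers 0).Dom}
    (hgap : ℓ.C₉ * ℓ.ω ^ ((objectsOfRecord₁₃ F N θ ℓ).levelCarriers 0).scale X * |g 0 - g' 0| *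
        Real.exp (-(ℓ.κ * ((objectsOfRecord₁₃ F N θ ℓ).levelCarriers 0).d X)) <
      |(objectsOfRecord₁₃ F N θ ℓ).EA 0 g U X - (objectsOfRecord₁₃ F N θ ℓ).EA 0 g' U X|) :
    ¬ NE9 ((objectsOfRecord₁₃ F N θ ℓ).EA 0) (Window θ.γ) ℓ.κ ℓ.moduli :=
  fun h9 => (not_lt.2 (abs_EA_objectsOfRecord₁₃_sub_le_of_h9_firstEntryOnly F N θ ℓ hs h9 hFE g hg g' hg' U X)) hgap

/-- ★★ **THE CONTRAPOSITIVE AT THE RECORD, EVERY BLOCK**: IF the record's kernel functional is first-entry-only on the window (FE-of-record, DISPLAYED — the functional does not read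
the block) AND it is NOT geometrically rigid — for every candidate `(C, ω, κ)` with `0 ≤ ω < 1`, `0 ≤ κ` some bare-coupling pair and domain beat `C·ω^{scale X}·|g 0 − g′ 0|·e^{−κ d(X)}`
(DISPLAYED) — THEN K3's N22 conjunct `h9` FAILS FOR EVERY letter block with `ℓ.Signs`: under H_FE′ the conjunct is inhabitable only by kernels that forget the bare coupling to
geometric order.  LOCATED; nothing of the record asserted; no stub refuted. [folklore] -/
theorem not_h9_of_firstEntryOnly_of_notRigid (θ : Stage13Params F N) (ℓ₀ : U3Letters₁₁)
    (hFE : ∀ g ∈ Window θ.γ, ∀ g' ∈ Window θ.γ, g 0 = g' 0 → ∀ (U : PUnit) (X : ((objectsOfRecord₁₃ F N θ ℓ₀).levelCarriers 0).Dom),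
      (objectsOfRecord₁₃ F N θ ℓ₀).EA 0 g U X = (objectsOfRecord₁₃ F N θ ℓ₀).EA 0 g' U X)
    (hNR : ∀ (Cc ω κ : ℝ), 0 ≤ ω → ω < 1 → 0 ≤ κ → ∃ g ∈ Window θ.γ, ∃ g' ∈ Window θ.γ, ∃ (U : PUnit) (X : ((objectsOfRecord₁₃ F N θ ℓ₀).levelCarriers 0).Dom),
      Cc * ω ^ ((objectsOfRecord₁₃ F N θ ℓ₀).levelCarriers 0).scale X * |g 0 - g' 0| * Real.exp (-(κ * ((objectsOfRecord₁₃ F N θ ℓ₀).levelCarriers 0).d X)) <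
        |(objectsOfRecord₁₃ F N θ ℓ₀).EA 0 g U X - (objectsOfRecord₁₃ F N θ ℓ₀).EA 0 g' U X|)
    (ℓ : U3Letters₁₁) (hs : ℓ.Signs) :
    ¬ NE9 ((objectsOfRecord₁₃ F N θ ℓ).EA 0) (Window θ.γ) ℓ.κ ℓ.moduli := by
  -- the level functional of the objects of record does not read the block (W1-19: `objects` stores the kernels; `ℓ` only fills the letter fields)
  obtain ⟨g, hg, g', hg', U, X, hgap⟩ := hNR ℓ.C₉ ℓ.ω ℓ.κ hs.ω_nonneg hs.ω_lt_one hs.κ_nonneg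
  exact not_h9_of_firstEntryOnly_of_gap F N θ ℓ hs hFE hg hg' hgap

variable {N}

/-- ★ **THE K3 PIN FACE**: under v5∕v6's node-U3 pin `hpin` (the rate reading's node-U3 objects at the tuple ARE the kernel objects of record), FE-of-record and non-rigidity
(both DISPLAYED) give ¬ `N22At (rateCarriersOfRecord₁₃CoPH 𝔯 F θ hP g₀ os k).u3` for every run length `k` and every block with `ℓ.Signs` — dag-n22-w3's
`n22At_u3OfRecord₁₃_objectsOfRecord₁₃_iff`, `→` direction.  LOCATED; no stub refuted (the antecedents are hypotheses). [folklore] -/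
theorem not_n22At_rateCarriers_pin_of_firstEntryOnly_of_notRigid (𝔯 : RateReading₁₃CoPH N) (θ : Stage13HParams F N) (hP : θ.Provisos₁₃CoPH F N)
    (g₀ : ℕ → ℝ) (os : List (ULoop F)) (ℓ : U3Letters₁₁) (hs : ℓ.Signs)
    (hpin : (𝔯.lit F θ hP g₀ os).u3 = objectsOfRecord₁₃ F N θ.toStage13Params ℓ)
    (hFE : ∀ g ∈ Window θ.γ, ∀ g' ∈ Window θ.γ, g 0 = g' 0 → ∀ (U : PUnit) (X : ((objectsOfRecord₁₃ F N θ.toStage13Params ℓ).levelCarriers 0).Dom),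
      (objectsOfRecord₁₃ F N θ.toStage13Params ℓ).EA 0 g U X = (objectsOfRecord₁₃ F N θ.toStage13Params ℓ).EA 0 g' U X)
    (hNR : ∀ (Cc ω κ : ℝ), 0 ≤ ω → ω < 1 → 0 ≤ κ → ∃ g ∈ Window θ.γ, ∃ g' ∈ Window θ.γ,
      ∃ (U : PUnit) (X : ((objectsOfRecord₁₃ F N θ.toStage13Params ℓ).levelCarriers 0).Dom),
      Cc * ω ^ ((objectsOfRecord₁₃ F N θ.toStage13Params ℓ).levelCarriers 0).scale X * |g 0 - g' 0| *
          Real.exp (-(κ * ((objectsOfRecord₁₃ F N θ.toStage13Params ℓ).levelCarriers 0).d X)) <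
        |(objectsOfRecord₁₃ F N θ.toStage13Params ℓ).EA 0 g U X - (objectsOfRecord₁₃ F N θ.toStage13Params ℓ).EA 0 g' U X|)
    (k : ℕ) : ¬ N22At (rateCarriersOfRecord₁₃CoPH 𝔯 F θ hP g₀ os k).u3 := by
  intro h
  have h' : N22At (u3OfRecord₁₃ θ.toStage13Params (𝔯.lit F θ hP g₀ os).u3 k) := h
  rw [hpin] at h'
  exact not_h9_of_firstEntryOnly_of_notRigid F N θ.toStage13Params ℓ hFE hNR ℓ hs
    ((n22At_u3OfRecord₁₃_objectsOfRecord₁₃_iff F N θ.toStage13Params ℓ hs k).1 h')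

end Record

/-! ## §3 AT CRIT-2's MARGINAL-TRANSPORT TOY in def-B currency: N22's letter with the record's moduli shape FAILS -/

section MarginalTransport

variable (F : T4Family) {a : HBeta} {β₀ α c : ℝ}

/-- **THE MIXED ENTRY AT A CONSTANT HISTORY**: for the two-bond family with the marginal-transport amplitude (DISPLAYED as dag-n18-w1 g6 displays it), at the constant history `s`
the level-`(k+1)` mixed kernel entry at the support point is `β₀ + α·s²∕(1 + c·k·s²)`. [folklore] -/
theorem kernelA_zero_one_const_marginalTransport (ha : ∀ (k : ℕ) (v : Fin (k + 1) → ℝ), a k v = β₀ + α * (v 0) ^ 2 / (1 + c * k * (v 0) ^ 2))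
    (e : Fin 4 → ℤ) (s : ℝ) (k : ℕ) :
    kernelA F (crossTermFamily F a e) (ContinuousLinearMap.id ℝ ℝ) (Module.Basis.singleton Unit ℝ) (fun _ => s) k 0 1 e = β₀ + α * s ^ 2 / (1 + c * k * s ^ 2) := by
  rw [kernelA_crossTermFamily, crossKernel_zero_one, if_pos rfl, ha]
  rfl

/-- **THE BARE-COUPLING GAP IS POLYNOMIAL, NOT GEOMETRIC**: at the two constant histories `γ` and `γ∕2` (`0 ≤ c`), the mixed entries at level `k + 1` differ by AT LEAST
`|α|·(3γ²∕4)∕(1 + c·k·γ²)²`. [folklore] -/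
theorem abs_kernelGap_const_marginalTransport_ge (ha : ∀ (k : ℕ) (v : Fin (k + 1) → ℝ), a k v = β₀ + α * (v 0) ^ 2 / (1 + c * k * (v 0) ^ 2)) (hc : 0 ≤ c)
    (e : Fin 4 → ℤ) (γ : ℝ) (k : ℕ) :
    |α| * (3 * γ ^ 2 / 4) / (1 + c * k * γ ^ 2) ^ 2 ≤
      |kernelA F (crossTermFamily F a e) (ContinuousLinearMap.id ℝ ℝ) (Module.Basis.singleton Unit ℝ) (fun _ => γ) k 0 1 e -
        kernelA F (crossTermFamily F a e) (ContinuousLinearMap.id ℝ ℝ) (Module.Basis.singleton Unit ℝ) (fun _ => γ / 2) k 0 1 e| := by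
  rw [kernelA_zero_one_const_marginalTransport F ha, kernelA_zero_one_const_marginalTransport F ha]
  have hk : (0 : ℝ) ≤ c * k := mul_nonneg hc (Nat.cast_nonneg k)
  have hD1 : 0 < 1 + c * k * γ ^ 2 := by positivity
  have hD2 : 0 < 1 + c * k * (γ / 2) ^ 2 := by positivity
  have hgap : β₀ + α * γ ^ 2 / (1 + c * ↑k * γ ^ 2) - (β₀ + α * (γ / 2) ^ 2 / (1 + c * ↑k * (γ / 2) ^ 2)) =
      α * (3 * γ ^ 2 / 4) / ((1 + c * k * γ ^ 2) * (1 + c * k * (γ / 2) ^ 2)) := by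
    field_simp
    ring
  rw [hgap, abs_div, abs_mul, abs_of_nonneg (by positivity : (0 : ℝ) ≤ 3 * γ ^ 2 / 4), abs_of_pos (mul_pos hD1 hD2)]
  -- the second denominator is at most the first
  have hle' : 1 + c * k * (γ / 2) ^ 2 ≤ 1 + c * k * γ ^ 2 := by nlinarith [sq_nonneg γ, hk]
  have hle : (1 + c * k * γ ^ 2) * (1 + c * k * (γ / 2) ^ 2) ≤ (1 + c * k * γ ^ 2) ^ 2 :=
    calc (1 + c * k * γ ^ 2) * (1 + c * k * (γ / 2) ^ 2) ≤ (1 + c * k * γ ^ 2) * (1 + c * k * γ ^ 2) := mul_le_mul_of_nonneg_left hle' hD1.le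
      _ = (1 + c * k * γ ^ 2) ^ 2 := by ring
  exact div_le_div_of_nonneg_left (by positivity) (mul_pos hD1 hD2) hle

/-- **POLYNOMIAL VERSUS GEOMETRIC**: `A∕(1 + b·k)² ≤ B·ω^{k+1}` for every `k`, with `A > 0`, `b ≥ 0`, `0 ≤ ω < 1`, is impossible (`(k+1)²·ω^{k+1} → 0`). [folklore] -/
theorem false_of_inv_sq_le_geometric {A b B ω : ℝ} (hA : 0 < A) (hb : 0 ≤ b) (hω0 : 0 ≤ ω) (hω1 : ω < 1)
    (h : ∀ k : ℕ, A / (1 + b * k) ^ 2 ≤ B * ω ^ (k + 1)) : False := by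
  have hω' : |ω| < 1 := by rw [abs_of_nonneg hω0]; exact hω1
  -- `u n = n²·ωⁿ → 0`, hence `u (k+1) → 0`
  have ht : Tendsto (fun k : ℕ => (((k + 1 : ℕ) : ℝ)) ^ 2 * ω ^ (k + 1)) atTop (𝓝 0) :=
    (tendsto_pow_const_mul_const_pow_of_abs_lt_one 2 hω').comp (tendsto_add_atTop_nat 1)
  have hpos : 0 < A / (|B| * (1 + b) ^ 2 + 1) := by positivity
  obtain ⟨K, hK⟩ := (Metric.tendsto_atTop.1 ht) (A / (|B| * (1 + b) ^ 2 + 1)) hpos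
  have hKK := hK K le_rfl
  rw [Real.dist_eq, sub_zero, abs_of_nonneg (by positivity)] at hKK
  -- from `h K`: `A ≤ B ω^{K+1} (1 + bK)² ≤ |B| (1+b)² (K+1)² ω^{K+1}`
  have hD : 0 < (1 + b * K) ^ 2 := by positivity
  have h1 : A ≤ B * ω ^ (K + 1) * (1 + b * K) ^ 2 := by
    have := h K
    rwa [div_le_iff₀ hD] at this
  have h2 : (1 + b * (K : ℝ)) ^ 2 ≤ (1 + b) ^ 2 * (((K + 1 : ℕ) : ℝ)) ^ 2 := by
    rw [← mul_pow]
    refine pow_le_pow_left₀ (by positivity) ?_ 2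
    push_cast
    nlinarith [Nat.cast_nonneg (α := ℝ) K]
  have h3 : B * ω ^ (K + 1) * (1 + b * K) ^ 2 ≤ |B| * (1 + b) ^ 2 * ((((K + 1 : ℕ) : ℝ)) ^ 2 * ω ^ (K + 1)) := by
    have hωK : 0 ≤ ω ^ (K + 1) := pow_nonneg hω0 _
    calc B * ω ^ (K + 1) * (1 + b * K) ^ 2 ≤ |B| * ω ^ (K + 1) * (1 + b * K) ^ 2 :=
          mul_le_mul_of_nonneg_right (mul_le_mul_of_nonneg_right (le_abs_self B) hωK) hD.le
      _ ≤ |B| * ω ^ (K + 1) * ((1 + b) ^ 2 * (((K + 1 : ℕ) : ℝ)) ^ 2) := mul_le_mul_of_nonneg_left h2 (mul_nonneg (abs_nonneg B) hωK)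
      _ = |B| * (1 + b) ^ 2 * ((((K + 1 : ℕ) : ℝ)) ^ 2 * ω ^ (K + 1)) := by ring
  have h4 : |B| * (1 + b) ^ 2 * ((((K + 1 : ℕ) : ℝ)) ^ 2 * ω ^ (K + 1)) < A := by
    have hM : 0 ≤ |B| * (1 + b) ^ 2 := by positivity
    have := mul_lt_mul_of_pos_left hKK (by positivity : 0 < |B| * (1 + b) ^ 2 + 1)
    rw [mul_div_cancel₀ _ (by positivity : |B| * (1 + b) ^ 2 + 1 ≠ 0)] at this
    nlinarith [mul_nonneg hM (le_of_lt (lt_of_le_of_lt (by positivity) hKK)), this,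
      mul_le_mul_of_nonneg_right (le_add_of_nonneg_right zero_le_one : |B| * (1 + b) ^ 2 ≤ |B| * (1 + b) ^ 2 + 1)
        (by positivity : 0 ≤ (((K + 1 : ℕ) : ℝ)) ^ 2 * ω ^ (K + 1))]
  linarith

/-- ★★ **N22's LETTER WITH THE RECORD's MODULI SHAPE FAILS AT THE MARGINAL-TRANSPORT TOY**: for the two-bond family with the amplitude law
`a k v = β₀ + α·(v 0)²∕(1 + c·k·(v 0)²)` (`α ≠ 0`, `0 ≤ c`), window `]0, γ]` (`0 < γ`), EVERY constant `C₉`, EVERY rate `ω ∈ [0, 1[` and EVERY decay letter `κ`: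
¬ `NE9 (EA …) (Window γ) κ (fun n i ↦ C₉·ω^{n−i})`.  The kernels read the bare coupling only and their bare-coupling memory fades POLYNOMIALLY (`∼ (1 + ckγ²)^{−2}`), so §1's
geometric rigidity is violated at a large level (`false_of_inv_sq_le_geometric`); a negative `C₉` is excluded at level `0` directly.  MODEL LEVEL. [folklore] -/
theorem not_ne9_geometric_marginalTransport (ha : ∀ (k : ℕ) (v : Fin (k + 1) → ℝ), a k v = β₀ + α * (v 0) ^ 2 / (1 + c * k * (v 0) ^ 2))
    (hα : α ≠ 0) (hc : 0 ≤ c) {γ : ℝ} (hγ : 0 < γ) (e : Fin 4 → ℤ) (C₉ : ℝ) {ω : ℝ} (hω0 : 0 ≤ ω) (hω1 : ω < 1) (κ : ℝ) :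
    ¬ NE9 (EA F (crossTermFamily F a e) (ContinuousLinearMap.id ℝ ℝ) (Module.Basis.singleton Unit ℝ)) (Window γ) κ (fun n i => C₉ * ω ^ (n - i)) := by
  intro h
  -- the model is first-entry-only
  have hFE : ∀ g ∈ Window γ, ∀ g' ∈ Window γ, g 0 = g' 0 → ∀ (k : ℕ) (μ ν : Fin 4) (z : Fin 4 → ℤ),
      kernelA F (crossTermFamily F a e) (ContinuousLinearMap.id ℝ ℝ) (Module.Basis.singleton Unit ℝ) g k μ ν z =
        kernelA F (crossTermFamily F a e) (ContinuousLinearMap.id ℝ ℝ) (Module.Basis.singleton Unit ℝ) g' k μ ν z := by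
    intro g _ g' _ h0 k μ ν z
    rw [kernelA_crossTermFamily, kernelA_crossTermFamily, ha, ha]
    simp only [histPrefix_apply, Fin.val_zero, h0]
  -- the two constant histories
  have hg : (fun _ : ℕ => γ) ∈ Window γ := fun _ => ⟨hγ, le_rfl⟩
  have hg' : (fun _ : ℕ => γ / 2) ∈ Window γ := fun _ => ⟨by linarith, by linarith⟩
  -- replace `C₉` by `max C₉ 0 ≥ 0`
  have h' : NE9 (EA F (crossTermFamily F a e) (ContinuousLinearMap.id ℝ ℝ) (Module.Basis.singleton Unit ℝ)) (Window γ) κ (fun n i => max C₉ 0 * ω ^ (n - i)) :=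
    ne9_mono h le_rfl (fun n i => mul_le_mul_of_nonneg_right (le_max_left _ _) (pow_nonneg hω0 _))
      (fun n i => mul_nonneg (le_max_right _ _) (pow_nonneg hω0 _))
  have hfm : FadingMemory (max C₉ 0) ω (fun n i => max C₉ 0 * ω ^ (n - i)) := fun _ _ _ => ⟨mul_nonneg (le_max_right _ _) (pow_nonneg hω0 _), le_rfl⟩
  have hrig := abs_kernelA_sub_le_of_ne9_fading_firstEntryOnly F (crossTermFamily F a e) (ContinuousLinearMap.id ℝ ℝ) (Module.Basis.singleton Unit ℝ) h' hfm hFE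
    _ hg _ hg'
  -- geometric upper bound against the polynomial lower bound, at `z = e`, every level
  have hA : 0 < |α| * (3 * γ ^ 2 / 4) := by positivity
  refine false_of_inv_sq_le_geometric hA (b := c * γ ^ 2) (B := max C₉ 0 * |γ - γ / 2| * Real.exp (-(κ * l1 e))) (by positivity) hω0 hω1 fun k => ?_
  have h1 := abs_kernelGap_const_marginalTransport_ge F ha hc e γ k
  have h2 := hrig k 0 1 e
  have e1 : (1 + c * γ ^ 2 * (k : ℝ)) ^ 2 = (1 + c * k * γ ^ 2) ^ 2 := by ring
  rw [e1]
  calc |α| * (3 * γ ^ 2 / 4) / (1 + c * ↑k * γ ^ 2) ^ 2 ≤ _ := h1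
    _ ≤ max C₉ 0 * ω ^ (k + 1) * |γ - γ / 2| * Real.exp (-(κ * l1 e)) := h2
    _ = max C₉ 0 * |γ - γ / 2| * Real.exp (-(κ * l1 e)) * ω ^ (k + 1) := by ring

variable {N : ℕ} [NeZero N]

/-- ★ **`N22At` FAILS AT THE MARGINAL-TRANSPORT TOY's KERNEL OBJECTS, FOR EVERY LETTER BLOCK**: for EVERY `ℓ : U3Letters₁₁` with `ℓ.Signs`, every Stage-13 tuple `θ` with
`0 < θ.γ` and every run length `k`, ¬ `N22At (u3OfRecord₁₃ θ (objects F (crossTermFamily F a e) id bV ℓ) k)` (dag-n22-w3's `n22At_u3OfRecord₁₃_objects_iff`, `→` direction, then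
`not_ne9_geometric_marginalTransport` at `(ℓ.C₉, ℓ.ω, ℓ.κ)`).  CONTRAST: at this seat's QUADRATIC FADING model the same slot HOLDS (`…N22KernelFadingOfStepRateModel.n22At_quadCross`).
MODEL LEVEL. [folklore] -/
theorem not_n22At_objects_marginalTransport (ha : ∀ (k : ℕ) (v : Fin (k + 1) → ℝ), a k v = β₀ + α * (v 0) ^ 2 / (1 + c * k * (v 0) ^ 2))
    (hα : α ≠ 0) (hc : 0 ≤ c) (e : Fin 4 → ℤ) (θ : Stage13Params F N) (hγ : 0 < θ.γ) (ℓ : U3Letters₁₁) (hs : ℓ.Signs) (k : ℕ) :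
    ¬ N22At (u3OfRecord₁₃ θ (objects F (crossTermFamily F a e) (ContinuousLinearMap.id ℝ ℝ) (Module.Basis.singleton Unit ℝ) ℓ) k) := by
  intro h
  have h9 := (n22At_u3OfRecord₁₃_objects_iff F (crossTermFamily F a e) (ContinuousLinearMap.id ℝ ℝ) (Module.Basis.singleton Unit ℝ) θ ℓ hs k).1 h
  exact not_ne9_geometric_marginalTransport F ha hα hc hγ e ℓ.C₉ hs.ω_nonneg hs.ω_lt_one ℓ.κ h9

end MarginalTransport

end YMDAG.N22.FadingLetterFirstEntryOnly

end
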